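import Literature.AlgebraicGeometry.Motives.WeilDatumHodgeStructure
import Literature.AlgebraicGeometry.Motives.WeilDiscriminantRealization
import HarnessLib

/-!
# The norm of `ℚ(√-d)` and the Weil polarization of the fibres of the Weil family

Van Geemen (LNM 1594, 4.9 and 5.7): for a polarized abelian variety of Weil type `(X, K, E)`,
`(√-d)^* E = dE`; more generally `E(kx, ky) = Nm_{K/ℚ}(k) E(x, y)` for all `k ∈ K = ℚ(√-d)`
(the tree's `HodgeStructure.EndAction.IsWeilPolarization`, Markman §1.1). This file proves:

* the NORM of the quadratic field `K = ℚ + ℚα`, `α² = -d` (`d > 0`), in the `ℚ`-basis `(1, α)`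
  of `Motives/WeilDiscriminantRealization.basisOneAlpha`: `Nm(a + bα) = a² + d b²`
  (`norm_algebraMap_add_mul`), and `k · σ(k) = Nm(k)` for the conjugation `σ` (`σ(α) = -α`)
  (`mul_conj_eq_algebraMap_norm`) — this is the hypothesis `hσ` carried by
  `Motives/WeilDiscriminantSplit`, `…Product`, `…Realization`, `Motives/WeilHermitianWitt`, now a
  theorem of `(d > 0, α² = -d, K = ℚ + ℚα)`;
* for a Weil datum in the `K`-module vocabulary (`WeilDatum.ofSMul`), `E(kx, ky) = Nm(k) E(x, y)`
  (`E_smul_smul`), hence the polarization `E` of EVERY fibre `J ∈ X⁺` of the Weil family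
  (`Motives/WeilDatumHodgeStructure.polarization`) is a WEIL POLARIZATION for the `K`-action
  (`isWeilPolarization_endAction`): together with `isOfWeilType_endAction` this makes each fibre a
  polarized Hodge structure of Weil type `(X, K, E)` in the full sense of van Geemen 4.9–4.10.

Everything is proved; no named fact is introduced.

## References

* [vanGeemen1994HodgeAV] B. van Geemen, LNM 1594 (1994), 4.9, Lemma 5.2 (2), 5.7.
* [Markman2025SecantWeil] E. Markman, arXiv:2509.23079, §1.1 (`η(k)` maps `h` to `Nm(k) h`).
* [Deligne1982HodgeCycles] P. Deligne, LNM 900 (1982), proof of Thm. 4.8, p. 48 (the Rosati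
  involution induces complex conjugation on `E`).
-/

noncomputable section

open Module

namespace Literature.AlgebraicGeometry.Motives

universe u

/-! ### The norm of `ℚ(√-d)` -/

section Norm

variable {K : Type*} [Field K] [Algebra ℚ K] {α : K} {d : ℚ} (hd : 0 < d)
  (hα : α * α = algebraMap ℚ K (-d)) (hK : ∀ k : K, ∃ a b : ℚ, k = algebraMap ℚ K a + algebraMap ℚ K b * α)

include hα in
/-- `(a + bα) · α = -bd + aα`. [folklore] -/
theorem algebraMap_add_mul_mul_alpha (a b : ℚ) :
    (algebraMap ℚ K a + algebraMap ℚ K b * α) * α = algebraMap ℚ K (-(b * d)) + algebraMap ℚ K a * α := by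
  rw [add_mul, mul_assoc, hα, ← map_mul, mul_neg, add_comm]

/-- The coordinates of `k ∈ K` in the basis `(1, α)`. [folklore] -/
theorem basisOneAlpha_repr (a b : ℚ) (i : Fin 2) :
    (basisOneAlpha hd hα hK).repr (algebraMap ℚ K a + algebraMap ℚ K b * α) i = ![a, b] i := by
  fin_cases i
  · exact reCoord_apply hd hα hK a b
  · exact imCoord_apply hd hα hK a b

include hd hα hK in
/-- **`Nm_{K/ℚ}(a + bα) = a² + d b²`** for `K = ℚ(α)`, `α² = -d`. [cite: vanGeemen1994HodgeAV, 4.9] -/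
theorem norm_algebraMap_add_mul (a b : ℚ) :
    Algebra.norm ℚ (algebraMap ℚ K a + algebraMap ℚ K b * α) = a ^ 2 + d * b ^ 2 := by
  classical
  set k := algebraMap ℚ K a + algebraMap ℚ K b * α
  rw [Algebra.norm_apply, ← LinearMap.det_toMatrix (basisOneAlpha hd hα hK), Matrix.det_fin_two]
  have h0 : (Algebra.lmul ℚ K k) (basisOneAlpha hd hα hK 0) = algebraMap ℚ K a + algebraMap ℚ K b * α := by
    rw [basisOneAlpha_apply_zero, Algebra.coe_lmul_eq_mul, LinearMap.mul_apply', mul_one]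
  have h1 : (Algebra.lmul ℚ K k) (basisOneAlpha hd hα hK 1) =
      algebraMap ℚ K (-(b * d)) + algebraMap ℚ K a * α := by
    rw [basisOneAlpha_apply_one, Algebra.coe_lmul_eq_mul, LinearMap.mul_apply',
      algebraMap_add_mul_mul_alpha hα]
  simp only [LinearMap.toMatrix_apply, h0, h1, basisOneAlpha_repr]
  simp
  ring

include hd hα hK in
/-- **`k · σ(k) = Nm(k)`** for the conjugation `σ` of `K = ℚ(√-d)` (`σ(α) = -α`):
`(a + bα)(a - bα) = a² + d b²`. This discharges the hypothesis `hσ` of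
`Motives/WeilDiscriminantSplit.discrClass_eq_of_isotropic`, `Motives/WeilHermitianWitt`, etc.
[cite: vanGeemen1994HodgeAV, Lemma 5.2 (3)] -/
theorem mul_conj_eq_algebraMap_norm (σ : K →+* K) (hσα : σ α = -α) (k : K) :
    k * σ k = algebraMap ℚ K (Algebra.norm ℚ k) := by
  have hσq : ∀ q : ℚ, σ (algebraMap ℚ K q) = algebraMap ℚ K q := fun q =>
    RingHom.congr_fun (RingHom.ext_rat (σ.comp (algebraMap ℚ K)) (algebraMap ℚ K)) q
  obtain ⟨a, b, rfl⟩ := hK k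
  rw [norm_algebraMap_add_mul hd hα hK, map_add, map_mul, hσα, hσq, hσq, map_add, map_mul, map_pow,
    map_pow]
  have h : (algebraMap ℚ K a + algebraMap ℚ K b * α) * (algebraMap ℚ K a + algebraMap ℚ K b * -α) =
      algebraMap ℚ K a ^ 2 - algebraMap ℚ K b ^ 2 * (α * α) := by ring
  rw [h, hα, map_neg]
  ring

end Norm

/-! ### `E(kx, ky) = Nm(k) E(x, y)`: the fibres carry a Weil polarization -/

namespace WeilDatum

variable {K : Type*} [Field K] {V : Type u} [AddCommGroup V] [Module ℚ V]

section General

variable [Algebra ℚ K] [Module K V] [IsScalarTower ℚ K V]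
  (E : LinearMap.BilinForm ℚ V) {α : K} {d : ℚ} (hd : 0 < d) (hα : α * α = algebraMap ℚ K (-d))
  (hE : ∀ x y, E y x = -E x y) (hW : ∀ x y, E (α • x) (α • y) = d * E x y) (hN : E.Nondegenerate)
  (hK : ∀ k : K, ∃ a b : ℚ, k = algebraMap ℚ K a + algebraMap ℚ K b * α)

include hd hα hE hW hN in
/-- `E(αx, y) = -E(x, αy)`. [cite: vanGeemen1994HodgeAV, proof of Lemma 5.2] -/
theorem E_smul_left (x y : V) : E (α • x) y = -E x (α • y) := by
  exact (ofSMul E hd hα hE hW hN).E_α_left x y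

include hd hα hE hW hN hK in
/-- **`E(kx, ky) = Nm_{K/ℚ}(k) E(x, y)`** for all `k ∈ K = ℚ(√-d)` ("`(√-d)^* E = dE`" extended by
bilinearity: the cross terms cancel by `E(αx, y) = -E(x, αy)`). [cite: vanGeemen1994HodgeAV, 4.9]
[cite: Markman2025SecantWeil, §1.1] -/
theorem E_smul_smul (k : K) (x y : V) : E (k • x) (k • y) = Algebra.norm ℚ k * E x y := by
  obtain ⟨a, b, rfl⟩ := hK k
  rw [norm_algebraMap_add_mul hd hα hK]
  simp only [add_smul, mul_smul, algebraMap_smul, map_add, map_smul, LinearMap.add_apply,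
    LinearMap.smul_apply, smul_eq_mul]
  rw [hW, E_smul_left E hd hα hE hW hN x y]
  ring

end General

section Fibre

variable [NumberField K] [Module K V] [IsScalarTower ℚ K V]
  (E : LinearMap.BilinForm ℚ V) {α : K} {d : ℚ} (hd : 0 < d) (hα : α * α = algebraMap ℚ K (-d))
  (hE : ∀ x y, E y x = -E x y) (hW : ∀ x y, E (α • x) (α • y) = d * E x y) (hN : E.Nondegenerate)
  (hK : ∀ k : K, ∃ a b : ℚ, k = algebraMap ℚ K a + algebraMap ℚ K b * α)

/-- **The polarization of every fibre `J ∈ X⁺` of the Weil family is a Weil polarization for the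
`K`-action** (`E(kx, ky) = Nm(k) E(x, y)`; the Rosati involution induces complex conjugation on `K`).
With `isOfWeilType_endAction` each fibre is thus a polarized Hodge structure of Weil type
`(X, K, E)`. [cite: vanGeemen1994HodgeAV, 4.9 and 5.7] [cite: Deligne1982HodgeCycles, proof of Thm. 4.8, p. 48 (a)] -/
theorem isWeilPolarization_endAction (J : (ofSMul E hd hα hE hW hN).Cx →ₗ[ℂ] (ofSMul E hd hα hE hW hN).Cx)
    (hWJ : IsWeilComplexStructure (ofSMul E hd hα hE hW hN).hForm J) :
    ((ofSMul E hd hα hE hW hN).endAction J α (fun v => (ofSMul_α_apply E hd hα hE hW hN v).symm) hK hWJ.sq).IsWeilPolarization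
      ((ofSMul E hd hα hE hW hN).polarization J hWJ) := by
  intro k x y
  rw [polarization_form, endAction_ι]
  exact E_smul_smul E hd hα hE hW hN hK k x y

end Fibre

end WeilDatum

end Literature.AlgebraicGeometry.Motives

end
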